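import Literature.Geometry.Kaehler.TorusDolbeaultAgreement
import Literature.Geometry.Kaehler.TorusDolbeaultPerturbation
import Literature.Geometry.Kaehler.ChartTorusFunSmul
import Literature.Geometry.Kaehler.ChartTorusL2
import Literature.Geometry.Kaehler.L2FunSmulBound
import Literature.NumberTheory.Transcendental.DolbeaultLaplacianLocality
import Literature.NumberTheory.Transcendental.KaehlerHodgeEllipticReductionProofs
import Literature.Analysis.FunctionSpaces.LatticeCutoffComm
import Literature.Analysis.FunctionSpaces.LatticeSobolevRellich
import Literature.Analysis.FunctionSpaces.TorusFourierCalculus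
import Literature.Analysis.FunctionSpaces.TorusTrigPoly
import HarnessLib

/-!
# Compactness of `Δ_∂̄` on one chart piece (Warner 6.33, 6.6)

F. W. Warner, GTM 94 (1983), 6.33 (proof of Theorem 6.6): for a bounded sequence `α_n` with
`‖Lα_n‖` bounded and a cut-off `φ` supported in a coordinate cube, the transferred sequence
`φ̃ α̃_n` is bounded in `H₁` by the fundamental inequality 6.29 (2) for the periodic elliptic
operator `L̃` of 6.31 (using `L(ω ⋆ u) = ω ⋆ Lu + [L, ω⋆]u`, 6.32 (10)–(11), and locality
`φ L(τα) = φ Lα`), hence has an `H₀`-Cauchy subsequence by Rellich 6.22 (3), and `φ α_{n_k}` is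
Cauchy in `L²` by the norm dictionary. We prove exactly this for `Δ_∂̄` on complex `(k+1)`-forms
(`CL2SmoothForms.exists_subseq_cauchySeq_fun_smul`, generic degree).

## References

* F. W. Warner, GTM 94 (1983), 6.22, 6.29, 6.31–6.33, Thm. 6.6. [WarnerGTM94]
-/

noncomputable section

open scoped Manifold ContDiff Topology NNReal ENNReal
open Bundle Set Function Module Metric Complex Filter MeasureTheory UnitAddTorus
open Literature.Analysis.FunctionSpaces Literature.Analysis.FunctionSpaces.Torus Literature.NumberTheory.Transcendental

set_option maxSynthPendingDepth 2

namespace Literature.Geometry.Kaehler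

/-! ### The lattice `H₀` norm of a continuous torus function -/

section Plancherel

variable {d : Type*} [Fintype d] {ι : Type*} [Fintype ι]

/-- **Parseval on the lattice side**: `‖𝓕g‖²_0 = ∫ ‖g‖²` for continuous `ℂ^N`-valued `g`.
[cite: WarnerGTM94, 6.33] -/
theorem eNormSq_zero_mFourierCoeff_eq_ofReal {g : UnitAddTorus d → EuclideanSpace ℂ ι} (hg : Continuous g) :
    Lattice.eNormSq 0 (mFourierCoeff g) = ENNReal.ofReal (∫ x, ‖g x‖ ^ 2) := by
  have hs := Torus.hasSum_sq_mFourierCoeff_euclidean hg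
  rw [Lattice.eNormSq_zero_eq_tsum, ← hs.tsum_eq,
    ENNReal.ofReal_tsum_of_nonneg (fun _ ↦ by positivity) hs.summable]
  refine tsum_congr fun k ↦ ?_
  rw [← ofReal_norm, ← ENNReal.ofReal_pow (norm_nonneg _)]

end Plancherel

/-! ### Transfer dictionary for differences -/

section Transfer

variable {E : Type*} [NormedAddCommGroup E] [NormedSpace ℝ E] {n : ℕ}
  {M : Type*} [TopologicalSpace M] [ChartedSpace E M]
  {F : Type*} [NormedAddCommGroup F] [NormedSpace ℝ F] {k : ℕ}
  {V : Type*} [NormedAddCommGroup V] [NormedSpace ℝ V]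
  {p : M} {A : E ≃L[ℝ] EuclideanSpace ℝ (Fin n)} (ι : (E [⋀^Fin k]→L[ℝ] F) →L[ℝ] V)

/-- The transfer of a difference. [folklore] -/
theorem MForm.toTorus_sub (β β' : MForm 𝓘(ℝ, E) M F k) :
    MForm.toTorus p A ι (β - β') = MForm.toTorus p A ι β - MForm.toTorus p A ι β' := by
  rw [sub_eq_add_neg, MForm.toTorus_add, ← neg_one_smul ℝ β', MForm.toTorus_smul, neg_one_smul,
    sub_eq_add_neg]

end Transfer

/-! ### The compactness step -/

section Compactness

variable {E : Type*} [NormedAddCommGroup E] [NormedSpace ℂ E] [FiniteDimensional ℂ E]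
  {n : ℕ} [Fact (finrank ℝ E = n)] [MeasurableSpace E] [BorelSpace E]
  {M : Type*} [TopologicalSpace M] [ChartedSpace E M] [T2Space M] [CompactSpace M]
  [IsManifold 𝓘(ℂ, E) ω M] [IsManifold 𝓘(ℝ, E) ∞ M]
  [RiemannianBundle (fun x : M ↦ TangentSpace 𝓘(ℝ, E) x)]
  [IsContMDiffRiemannianBundle 𝓘(ℝ, E) ∞ E (fun x : M ↦ TangentSpace 𝓘(ℝ, E) x)]
  (o : (x : M) → Orientation ℝ (TangentSpace 𝓘(ℝ, E) x) (Fin n)) {k m : ℕ}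
  [Fact (IsSmoothForm (riemannianVolumeForm o))]
  {p : M} {A : E ≃L[ℝ] EuclideanSpace ℝ (Fin n)}

omit [IsManifold 𝓘(ℂ, E) ω M] in
/-- **The `L²` norm on `M` and the torus `L²` norm of the transfer are equivalent** on forms
supported in the chart preimage of the inner cube region (constant chart sign there):
`C₁ ∫‖Tα‖² ≤ ‖α‖² ≤ C₂ ∫‖Tα‖²` with the transfer through `fibreIsoℝ`. [cite: WarnerGTM94, 6.33] -/
theorem exists_norm_sq_toTorus_bounds (𝒞 : CubeCutoff p A) (j : ℕ) {εs : ℝ}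
    (hsign : ∀ y ∈ cubeRegion A (extChartAt 𝓘(ℝ, E) p p) 𝒞.ρ, chartSign o p y = εs) :
    ∃ C₁ C₂ : ℝ, 0 < C₁ ∧ ∀ ⦃α : MForm 𝓘(ℝ, E) M ℂ j⦄ (hα : IsSmoothForm α),
      (∀ x, α x ≠ 0 → x ∈ (extChartAt 𝓘(ℝ, E) p).source ∧
        extChartAt 𝓘(ℝ, E) p x ∈ cubeRegion A (extChartAt 𝓘(ℝ, E) p p) 𝒞.ρ) →
      C₁ * ∫ x, ‖MForm.toTorus p A (fibreIsoℝ E j) α x‖ ^ 2 ≤ ‖CL2SmoothForms.mk o α hα‖ ^ 2 ∧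
      ‖CL2SmoothForms.mk o α hα‖ ^ 2 ≤ C₂ * ∫ x, ‖MForm.toTorus p A (fibreIsoℝ E j) α x‖ ^ 2 := by
  -- the fibre identification as a real continuous linear equivalence
  let ιR : (E [⋀^Fin j]→L[ℝ] ℂ) ≃L[ℝ] EuclideanSpace ℂ (Fin (fibreDim E j)) :=
    { (fibreIso E j).toLinearEquiv.restrictScalars ℝ with
      continuous_toFun := (fibreIso E j).continuous
      continuous_invFun := (fibreIso E j).symm.continuous }
  have hco : ((ιR : (E [⋀^Fin j]→L[ℝ] ℂ) ≃L[ℝ] EuclideanSpace ℂ (Fin (fibreDim E j))) :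
        (E [⋀^Fin j]→L[ℝ] ℂ) →L[ℝ] EuclideanSpace ℂ (Fin (fibreDim E j))) = fibreIsoℝ E j := by
    ext a
    rfl
  have h := CL2SmoothForms.exists_norm_sq_torus_bounds o p A 𝒞.ρ_lt_half (𝒞.region_mono.trans 𝒞.region_subset)
    hsign ιR
  rw [hco] at h
  exact h

omit [FiniteDimensional ℂ E] [MeasurableSpace E] [BorelSpace E] [T2Space M] [CompactSpace M] [IsManifold 𝓘(ℂ, E) ω M]
  [IsManifold 𝓘(ℝ, E) ∞ M] [RiemannianBundle (fun x : M ↦ TangentSpace 𝓘(ℝ, E) x)]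
  [IsContMDiffRiemannianBundle 𝓘(ℝ, E) ∞ E (fun x : M ↦ TangentSpace 𝓘(ℝ, E) x)] in
/-- Support of a function multiple inside the support condition of the function. [folklore] -/
theorem support_fun_smul_of {ρ : M → ℝ} {S : M → Prop} (hρ : ∀ x, ρ x ≠ 0 → S x) {j : ℕ}
    (β : MForm 𝓘(ℝ, E) M ℂ j) : ∀ x, (ρ • β) x ≠ 0 → S x := fun x hx ↦
  hρ x fun h ↦ hx (by rw [Pi.smul_apply', h, zero_smul])

omit [IsManifold 𝓘(ℂ, E) ω M] in
/-- **Warner 6.33 on one chart piece, abstract form**: let `L̃` be an elliptic lattice operator with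
small principal perturbation which agrees, after transfer, with an operator `Δ` on smooth `j`-forms
supported in the chart preimage of the inner region (`hagree`), where `Δ` preserves smoothness and
such supports and is local (`φ Δ(τβ) = φ Δβ`); let `ΔL` be its action on `A^j(M; ℂ)`. Then every
sequence `u` with `‖u_i‖`, `‖ΔL u_i‖` bounded has a subsequence along which `φ u_i` is Cauchy.
[cite: WarnerGTM94, 6.33] -/
theorem CL2SmoothForms.exists_subseq_cauchySeq_fun_smul_of_agreement {j : ℕ} (𝒞 : CubeCutoff p A)
    (L : Lattice.POp (Fin n) (EuclideanSpace ℂ (Fin (fibreDim E j))) (EuclideanSpace ℂ (Fin (fibreDim E j))))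
    {κ : ℝ} (hκ : 0 < κ) (hell : L.IsEllipticWith κ) {ε : ℝ≥0∞} (hpert : L.PrincipalPerturbationLE ε)
    (hε : ENNReal.ofReal (2 * Real.sqrt 2 / κ) * (Fintype.card (Fin n) : ℝ≥0∞) ^ 2 * ε ≤ 1)
    {εs : ℝ} (hsign : ∀ y ∈ cubeRegion A (extChartAt 𝓘(ℝ, E) p p) 𝒞.ρ, chartSign o p y = εs)
    (Δ : MForm 𝓘(ℝ, E) M ℂ j → MForm 𝓘(ℝ, E) M ℂ j) (hΔs : ∀ {β}, IsSmoothForm β → IsSmoothForm (Δ β))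
    (hΔsupp : ∀ {β}, IsSmoothForm β →
      (∀ x, β x ≠ 0 → x ∈ (extChartAt 𝓘(ℝ, E) p).source ∧
        extChartAt 𝓘(ℝ, E) p x ∈ cubeRegion A (extChartAt 𝓘(ℝ, E) p p) 𝒞.ρ) →
      ∀ x, Δ β x ≠ 0 → x ∈ (extChartAt 𝓘(ℝ, E) p).source ∧
        extChartAt 𝓘(ℝ, E) p x ∈ cubeRegion A (extChartAt 𝓘(ℝ, E) p p) 𝒞.ρ)
    (hΔloc : ∀ {φ τ : M → ℝ}, (∀ x, φ x ≠ 0 → ∀ᶠ w in 𝓝 x, τ w = 1) → ∀ β, φ • Δ (τ • β) = φ • Δ β)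
    (hagree : ∀ {β}, IsSmoothForm β →
      (∀ x, β x ≠ 0 → x ∈ (extChartAt 𝓘(ℝ, E) p).source ∧
        extChartAt 𝓘(ℝ, E) p x ∈ cubeRegion A (extChartAt 𝓘(ℝ, E) p p) 𝒞.ρ) →
      mFourierCoeff (MForm.toTorus p A (fibreIsoℝ E j) (Δ β)) = L.apply (mFourierCoeff (MForm.toTorus p A (fibreIsoℝ E j) β)))
    (ΔL : CL2SmoothForms o j → CL2SmoothForms o j)
    (hΔL : ∀ α, CL2SmoothForms.toForm o (ΔL α) = Δ (CL2SmoothForms.toForm o α))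
    {φ τ : M → ℝ} (hφ : ContMDiff 𝓘(ℝ, E) 𝓘(ℝ) ∞ φ) (hτ : ContMDiff 𝓘(ℝ, E) 𝓘(ℝ) ∞ τ)
    (hφ1 : ∀ x, |φ x| ≤ 1) (hτ1 : ∀ x, |τ x| ≤ 1) (hτφ : ∀ x, φ x ≠ 0 → ∀ᶠ w in 𝓝 x, τ w = 1)
    (hKτ : ∀ x, τ x ≠ 0 → x ∈ (extChartAt 𝓘(ℝ, E) p).source ∧
      extChartAt 𝓘(ℝ, E) p x ∈ cubeRegion A (extChartAt 𝓘(ℝ, E) p p) 𝒞.ρ)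
    (u : ℕ → CL2SmoothForms o j) {c : ℝ} (hb : ∀ i, ‖u i‖ ≤ c) (hΔ : ∀ i, ‖ΔL (u i)‖ ≤ c) :
    ∃ ψ : ℕ → ℕ, StrictMono ψ ∧ CauchySeq (fun i ↦ CL2SmoothForms.mk o (φ • CL2SmoothForms.toForm o (u (ψ i)))
      ((CL2SmoothForms.isSmoothForm_toForm o _).fun_smul' hφ)) := by
  have ho : IsSmoothForm (riemannianVolumeForm o) := Fact.out
  -- supports
  have hKφ : ∀ x, φ x ≠ 0 → x ∈ (extChartAt 𝓘(ℝ, E) p).source ∧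
      extChartAt 𝓘(ℝ, E) p x ∈ cubeRegion A (extChartAt 𝓘(ℝ, E) p p) 𝒞.ρ := fun x hx ↦
    hKτ x (by rw [(hτφ x hx).self_of_nhds]; exact one_ne_zero)
  have hφτ : ∀ (β : MForm 𝓘(ℝ, E) M ℂ j), φ • (τ • β) = φ • β := fun β ↦ by
    funext x
    simp only [Pi.smul_apply']
    by_cases hx : φ x = 0
    · rw [hx, zero_smul, zero_smul]
    · rw [(hτφ x hx).self_of_nhds, one_smul]
  -- norm dictionary on the inner region, degree `k + 1`
  obtain ⟨C₁, C₂, hC₁, hcmp⟩ := exists_norm_sq_toTorus_bounds o 𝒞 j hsign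
  -- the smooth periodic cut-off and its symbol
  have hφs : Torus.IsSmooth (𝒞.torusFun φ) := 𝒞.isSmooth_torusFun hφ
  set χ : (Fin n → ℤ) → ℂ := mFourierCoeff (𝒞.torusFun φ) with hχ
  have hχR : RapidDecay χ := hφs.rapidDecay_mFourierCoeff
  -- the transferred sequences
  set T : MForm 𝓘(ℝ, E) M ℂ j → UnitAddTorus (Fin n) → EuclideanSpace ℂ (Fin (fibreDim E j)) :=
    MForm.toTorus p A (fibreIsoℝ E j) with hT
  have hsm : ∀ i, IsSmoothForm (CL2SmoothForms.toForm o (u i)) := fun i ↦ CL2SmoothForms.isSmoothForm_toForm o _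
  have hτu : ∀ i, IsSmoothForm (τ • CL2SmoothForms.toForm o (u i)) := fun i ↦ (hsm i).fun_smul' hτ
  have hφu : ∀ i, IsSmoothForm (φ • CL2SmoothForms.toForm o (u i)) := fun i ↦ (hsm i).fun_smul' hφ
  have hKτu : ∀ i x, (τ • CL2SmoothForms.toForm o (u i)) x ≠ 0 → x ∈ (extChartAt 𝓘(ℝ, E) p).source ∧
      extChartAt 𝓘(ℝ, E) p x ∈ cubeRegion A (extChartAt 𝓘(ℝ, E) p p) 𝒞.ρ := fun i ↦ support_fun_smul_of hKτ _
  have hKφu : ∀ i x, (φ • CL2SmoothForms.toForm o (u i)) x ≠ 0 → x ∈ (extChartAt 𝓘(ℝ, E) p).source ∧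
      extChartAt 𝓘(ℝ, E) p x ∈ cubeRegion A (extChartAt 𝓘(ℝ, E) p p) 𝒞.ρ := fun i ↦ support_fun_smul_of hKφ _
  have hg : ∀ i, Torus.IsSmooth (T (τ • CL2SmoothForms.toForm o (u i))) := fun i ↦
    MForm.isSmooth_toTorus _ 𝒞.ρ_lt_half (hτu i) (𝒞.region_mono.trans 𝒞.region_subset) (hKτu i)
  have hw : ∀ i, Torus.IsSmooth (T (φ • CL2SmoothForms.toForm o (u i))) := fun i ↦
    MForm.isSmooth_toTorus _ 𝒞.ρ_lt_half (hφu i) (𝒞.region_mono.trans 𝒞.region_subset) (hKφu i)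
  set ĝ : ℕ → (Fin n → ℤ) → EuclideanSpace ℂ (Fin (fibreDim E j)) :=
    fun i ↦ mFourierCoeff (T (τ • CL2SmoothForms.toForm o (u i))) with hĝ
  set w : ℕ → (Fin n → ℤ) → EuclideanSpace ℂ (Fin (fibreDim E j)) :=
    fun i ↦ mFourierCoeff (T (φ • CL2SmoothForms.toForm o (u i))) with hwdef
  -- (F1) `w = χ ⋆ ĝ`
  have F1 : ∀ i, w i = Lattice.conv (Lattice.scal χ) (ĝ i) := fun i ↦ by
    simp only [hwdef, hĝ, hχ]
    rw [← hφτ, hT, MForm.toTorus_fun_smul 𝒞 _ φ (hKτu i)]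
    exact hφs.mFourierCoeff_smul_eq_conv_scal (hg i)
  -- (F3) `χ ⋆ 𝓕T(Δ(τu)) = 𝓕T(φ Δu)`
  have hΔτ : ∀ i, IsSmoothForm (Δ (τ • CL2SmoothForms.toForm o (u i))) :=
    fun i ↦ hΔs (hτu i)
  have hKΔτ : ∀ i x, Δ (τ • CL2SmoothForms.toForm o (u i)) x ≠ 0 →
      x ∈ (extChartAt 𝓘(ℝ, E) p).source ∧
        extChartAt 𝓘(ℝ, E) p x ∈ cubeRegion A (extChartAt 𝓘(ℝ, E) p p) 𝒞.ρ := fun i ↦ hΔsupp (hτu i) (hKτu i)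
  have F3 : ∀ i, Lattice.conv (Lattice.scal χ)
      (mFourierCoeff (T (Δ (τ • CL2SmoothForms.toForm o (u i))))) =
      mFourierCoeff (T (φ • Δ (CL2SmoothForms.toForm o (u i)))) := fun i ↦ by
    rw [← hφs.mFourierCoeff_smul_eq_conv_scal (MForm.isSmooth_toTorus _ 𝒞.ρ_lt_half (hΔτ i)
      (𝒞.region_mono.trans 𝒞.region_subset) (hKΔτ i)), ← hΔloc hτφ,
      hT, MForm.toTorus_fun_smul 𝒞 _ φ (hKΔτ i)]
  -- (F2) `L̃ w = 𝓕T(φΔu) + Comm ĝ`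
  have F2 : ∀ i, L.apply (w i) =
      mFourierCoeff (T (φ • Δ (CL2SmoothForms.toForm o (u i)))) +
        (L.cutoffComm χ hχR).apply (ĝ i) := fun i ↦ by
    have hLg : L.apply (ĝ i) =
        mFourierCoeff (T (Δ (τ • CL2SmoothForms.toForm o (u i)))) := by
      simp only [hĝ, hT]
      exact (hagree (hτu i) (hKτu i)).symm
    rw [F1, Lattice.POp.apply_conv_scal L hχR (hg i).rapidDecay_mFourierCoeff.tempered, hLg, F3]
  -- (F4) the `H₀` bounds through the norm dictionary
  have hreg : cubeRegion A (extChartAt 𝓘(ℝ, E) p p) 𝒞.ρ ⊆ (extChartAt 𝓘(ℝ, E) p).target :=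
    𝒞.region_mono.trans 𝒞.region_subset
  have hc0 : 0 ≤ c := (norm_nonneg _).trans (hb 0)
  have hB0 : ∀ {α : MForm 𝓘(ℝ, E) M ℂ j} (hα : IsSmoothForm α),
      (∀ x, α x ≠ 0 → x ∈ (extChartAt 𝓘(ℝ, E) p).source ∧
        extChartAt 𝓘(ℝ, E) p x ∈ cubeRegion A (extChartAt 𝓘(ℝ, E) p p) 𝒞.ρ) →
      ‖CL2SmoothForms.mk o α hα‖ ≤ c → Lattice.eNormSq 0 (mFourierCoeff (T α)) ≤ ENNReal.ofReal (c ^ 2 / C₁) := by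
    intro α hα hK hn
    rw [hT, eNormSq_zero_mFourierCoeff_eq_ofReal (MForm.isSmooth_toTorus _ 𝒞.ρ_lt_half hα hreg hK).continuous]
    refine ENNReal.ofReal_le_ofReal ?_
    rw [le_div_iff₀ hC₁, mul_comm]
    have h1 := (hcmp hα hK).1
    have h2 : ‖CL2SmoothForms.mk o α hα‖ ^ 2 ≤ c ^ 2 := pow_le_pow_left₀ (norm_nonneg _) hn 2
    exact h1.trans h2
  have b1 : ∀ i, Lattice.eNormSq 0 (ĝ i) ≤ ENNReal.ofReal (c ^ 2 / C₁) := fun i ↦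
    hB0 (hτu i) (hKτu i) ((CL2SmoothForms.norm_mk_fun_smul_le o hτ hτ1 (hsm i)).trans (hb i))
  have b3 : ∀ i, Lattice.eNormSq 0 (w i) ≤ ENNReal.ofReal (c ^ 2 / C₁) := fun i ↦
    hB0 (hφu i) (hKφu i) ((CL2SmoothForms.norm_mk_fun_smul_le o hφ hφ1 (hsm i)).trans (hb i))
  have hΔs' : ∀ i, IsSmoothForm (Δ (CL2SmoothForms.toForm o (u i))) :=
    fun i ↦ hΔs (hsm i)
  have b2 : ∀ i, Lattice.eNormSq 0 (mFourierCoeff (T (φ • Δ (CL2SmoothForms.toForm o (u i))))) ≤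
      ENNReal.ofReal (c ^ 2 / C₁) := fun i ↦ by
    refine hB0 ((hΔs' i).fun_smul' hφ) (support_fun_smul_of hKφ _)
      ((CL2SmoothForms.norm_mk_fun_smul_le o hφ hφ1 (hΔs' i)).trans ?_)
    have : CL2SmoothForms.mk o (Δ (CL2SmoothForms.toForm o (u i))) (hΔs' i) = ΔL (u i) := by
      apply (CL2SmoothForms.toForm_inj o).1
      rw [CL2SmoothForms.toForm_mk, hΔL]
    rw [this]
    exact hΔ i
  -- square roots of the `H₀` bounds
  set B : ℝ≥0∞ := (ENNReal.ofReal (c ^ 2 / C₁)) ^ (1 / 2 : ℝ) with hBdef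
  have hBtop : B < ⊤ := ENNReal.rpow_lt_top_of_nonneg (by norm_num) ENNReal.ofReal_ne_top
  have hsqrt : ∀ {x : (Fin n → ℤ) → EuclideanSpace ℂ (Fin (fibreDim E j))},
      Lattice.eNormSq 0 x ≤ ENNReal.ofReal (c ^ 2 / C₁) → Lattice.eNorm 0 x ≤ B := fun hx ↦ by
    rw [Lattice.eNorm_eq_rpow, hBdef]
    exact ENNReal.rpow_le_rpow hx (by norm_num)
  -- (F5) the fundamental inequality gives a uniform `H₁` bound
  obtain ⟨C, hC, hfi⟩ := Lattice.POp.fundamental_inequality L hκ hell hpert hε 1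
  have e1 : (2 : ℝ) - ((1 : ℕ) : ℝ) = 1 := by norm_num
  have e2 : -(((1 : ℕ) : ℝ)) = -1 := by norm_num
  rw [e1, e2] at hfi
  set Kc : ℝ≥0∞ := (L.cutoffComm χ hχR).bound (-1) with hKc
  have hKctop : Kc < ⊤ := Lattice.POp1.bound_lt_top _ _
  set R' : ℝ≥0∞ := C * ((B + Kc * B) + B) with hR'
  have hR'top : R' < ⊤ :=
    ENNReal.mul_lt_top hC (ENNReal.add_lt_top.2 ⟨ENNReal.add_lt_top.2 ⟨hBtop, ENNReal.mul_lt_top hKctop hBtop⟩, hBtop⟩)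
  have h1bound : ∀ i, Lattice.eNorm 1 (w i) ≤ R' := fun i ↦ by
    have hfin : Lattice.eNormSq 1 (w i) < ⊤ := Lattice.eNormSq_lt_top_of_rapidDecay (hw i).rapidDecay_mFourierCoeff _
    refine (hfi (w i) hfin).trans ?_
    rw [hR']
    refine mul_le_mul' le_rfl (add_le_add ?_ ((Lattice.eNorm_mono (by norm_num) _).trans (hsqrt (b3 i))))
    rw [F2 i]
    refine (Lattice.eNorm_add_le _ _ _).trans (add_le_add ?_ ?_)
    · exact (Lattice.eNorm_mono (by norm_num) _).trans (hsqrt (b2 i))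
    · have h3 := Lattice.POp1.eNorm_apply_le (L.cutoffComm χ hχR) (-1) (ĝ i)
      rw [show (-1 : ℝ) + 1 = 0 by norm_num] at h3
      exact h3.trans (mul_le_mul' le_rfl (hsqrt (b1 i)))
  have hRbound : ∀ i, Lattice.eNormSq 1 (w i) ≤ R' ^ 2 := fun i ↦ by
    rw [← Lattice.eNorm_pow_two]
    exact pow_le_pow_left₀ zero_le (h1bound i) 2
  have hRtop : R' ^ 2 ≠ ⊤ := (ENNReal.pow_lt_top hR'top).ne
  -- (F6) Rellich: an `H₀`-Cauchy subsequence
  obtain ⟨ψ, hψ, hCau⟩ := Lattice.rellich (s := 0) (t := 1) zero_lt_one hRtop hRbound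
  -- (F7) back to `M`
  refine ⟨ψ, hψ, Metric.cauchySeq_iff.2 fun δ hδ ↦ ?_⟩
  set C₂' : ℝ := max C₂ 1 with hC₂'
  have hC₂'pos : 0 < C₂' := lt_max_of_lt_right one_pos
  obtain ⟨N, hN⟩ := hCau (ENNReal.ofReal (δ ^ 2 / (2 * C₂'))) (ENNReal.ofReal_pos.2 (by positivity))
  refine ⟨N, fun i hi i' hi' ↦ ?_⟩
  -- the difference form
  set α : MForm 𝓘(ℝ, E) M ℂ j :=
    φ • (CL2SmoothForms.toForm o (u (ψ i)) - CL2SmoothForms.toForm o (u (ψ i'))) with hαdef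
  have hαs : IsSmoothForm α := ((hsm _).sub (hsm _)).fun_smul' hφ
  have hKα : ∀ x, α x ≠ 0 → x ∈ (extChartAt 𝓘(ℝ, E) p).source ∧
      extChartAt 𝓘(ℝ, E) p x ∈ cubeRegion A (extChartAt 𝓘(ℝ, E) p p) 𝒞.ρ := support_fun_smul_of hKφ _
  have hmk : CL2SmoothForms.mk o (φ • CL2SmoothForms.toForm o (u (ψ i))) ((CL2SmoothForms.isSmoothForm_toForm o _).fun_smul' hφ) -
      CL2SmoothForms.mk o (φ • CL2SmoothForms.toForm o (u (ψ i'))) ((CL2SmoothForms.isSmoothForm_toForm o _).fun_smul' hφ) =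
      CL2SmoothForms.mk o α hαs := by
    apply (CL2SmoothForms.toForm_inj o).1
    simp only [CL2SmoothForms.toForm_sub, CL2SmoothForms.toForm_mk, hαdef, smul_sub]
  have hTα : T α = T (φ • CL2SmoothForms.toForm o (u (ψ i))) - T (φ • CL2SmoothForms.toForm o (u (ψ i'))) := by
    rw [hαdef, smul_sub, hT, MForm.toTorus_sub]
  have hFα : mFourierCoeff (T α) = w (ψ i) - w (ψ i') := by
    funext kv
    rw [hTα, Pi.sub_apply]
    exact Torus.mFourierCoeff_sub (hw _).integrable (hw _).integrable kv
  have hint : ∫ x, ‖T α x‖ ^ 2 = (Lattice.eNormSq 0 (w (ψ i) - w (ψ i'))).toReal := by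
    rw [← hFα, hT, eNormSq_zero_mFourierCoeff_eq_ofReal
      (MForm.isSmooth_toTorus _ 𝒞.ρ_lt_half hαs hreg hKα).continuous, ENNReal.toReal_ofReal]
    exact integral_nonneg fun _ ↦ by positivity
  have hle : (Lattice.eNormSq 0 (w (ψ i) - w (ψ i'))).toReal ≤ δ ^ 2 / (2 * C₂') := by
    have := hN i i' hi hi'
    exact (ENNReal.toReal_le_toReal (ne_top_of_le_ne_top ENNReal.ofReal_ne_top this) ENNReal.ofReal_ne_top).2 this
      |>.trans_eq (ENNReal.toReal_ofReal (by positivity))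
  have hsq : ‖CL2SmoothForms.mk o α hαs‖ ^ 2 < δ ^ 2 := by
    have h2 := (hcmp hαs hKα).2
    have hI : 0 ≤ ∫ x, ‖T α x‖ ^ 2 := integral_nonneg fun _ ↦ by positivity
    calc ‖CL2SmoothForms.mk o α hαs‖ ^ 2 ≤ C₂ * ∫ x, ‖T α x‖ ^ 2 := h2
      _ ≤ C₂' * ∫ x, ‖T α x‖ ^ 2 := mul_le_mul_of_nonneg_right (le_max_left _ _) hI
      _ ≤ C₂' * (δ ^ 2 / (2 * C₂')) := by rw [hint]; exact mul_le_mul_of_nonneg_left hle hC₂'pos.le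
      _ = δ ^ 2 / 2 := by field_simp
      _ < δ ^ 2 := by linarith [pow_pos hδ 2]
  rw [dist_eq_norm, hmk]
  exact lt_of_pow_lt_pow_left₀ 2 hδ.le hsq


/-- **Warner 6.33 on one chart piece for `Δ_∂̄`** (generic degree `(k+1) + (m+1) = n`): with cut-off
data whose torus Laplacian is elliptic with small principal perturbation and constant chart sign on
the inner region, and `φ, τ` as above, every sequence in `A^{k+1}(M; ℂ)` with `‖u_i‖`, `‖Δ_∂̄ u_i‖`
bounded has a subsequence along which `φ u_i` is Cauchy in `L²`. [cite: WarnerGTM94, 6.33] -/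
theorem CL2SmoothForms.exists_subseq_cauchySeq_fun_smul (h : (k + 1) + (m + 1) = n) (𝒞 : CubeCutoff p A)
    {κ : ℝ} (hκ : 0 < κ)
    (hell : (torusLaplacian o Fact.out h (show (k + 1 + 1) + m = n by omega) 𝒞).IsEllipticWith κ)
    {ε : ℝ≥0∞} (hpert : (torusLaplacian o Fact.out h (show (k + 1 + 1) + m = n by omega) 𝒞).PrincipalPerturbationLE ε)
    (hε : ENNReal.ofReal (2 * Real.sqrt 2 / κ) * (Fintype.card (Fin n) : ℝ≥0∞) ^ 2 * ε ≤ 1)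
    {εs : ℝ} (hsign : ∀ y ∈ cubeRegion A (extChartAt 𝓘(ℝ, E) p p) 𝒞.ρ, chartSign o p y = εs)
    {φ τ : M → ℝ} (hφ : ContMDiff 𝓘(ℝ, E) 𝓘(ℝ) ∞ φ) (hτ : ContMDiff 𝓘(ℝ, E) 𝓘(ℝ) ∞ τ)
    (hφ1 : ∀ x, |φ x| ≤ 1) (hτ1 : ∀ x, |τ x| ≤ 1) (hτφ : ∀ x, φ x ≠ 0 → ∀ᶠ w in 𝓝 x, τ w = 1)
    (hKτ : ∀ x, τ x ≠ 0 → x ∈ (extChartAt 𝓘(ℝ, E) p).source ∧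
      extChartAt 𝓘(ℝ, E) p x ∈ cubeRegion A (extChartAt 𝓘(ℝ, E) p p) 𝒞.ρ)
    (u : ℕ → CL2SmoothForms o (k + 1)) {c : ℝ} (hb : ∀ i, ‖u i‖ ≤ c)
    (hΔ : ∀ i, ‖CL2SmoothForms.dolbeaultLaplacian o h (u i)‖ ≤ c) :
    ∃ ψ : ℕ → ℕ, StrictMono ψ ∧ CauchySeq (fun i ↦ CL2SmoothForms.mk o (φ • CL2SmoothForms.toForm o (u (ψ i)))
      ((CL2SmoothForms.isSmoothForm_toForm o _).fun_smul' hφ)) := by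
  have ho : IsSmoothForm (riemannianVolumeForm o) := Fact.out
  refine CL2SmoothForms.exists_subseq_cauchySeq_fun_smul_of_agreement o 𝒞 _ hκ hell hpert hε hsign
    (dolbeaultLaplacian o (k + 1) (m + 1) h) (fun hβ ↦ IsSmoothForm.dolbeaultLaplacian o ho h hβ)
    (fun {β} hβ hK ↦ ?_) (fun hτφ β ↦ fun_smul_dolbeaultLaplacian_fun_smul o h hτφ β)
    (fun hβ hK ↦ mFourierCoeff_toTorus_dolbeaultLaplacian o ho h 𝒞 hβ hK)
    (CL2SmoothForms.dolbeaultLaplacian o h) (fun α ↦ rfl) hφ hτ hφ1 hτ1 hτφ hKτ u hb hΔ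
  -- support preservation of `Δ_∂̄ = ∂̄∂̄* + ∂̄*∂̄`
  have h1 : dolbeaultLaplacian o (k + 1) (m + 1) h β =
      dolbeaultBar (dolbeaultBarAdjoint o h β) +
        dolbeaultBarAdjoint o (show (k + 1 + 1) + m = n by omega) (dolbeaultBar β) := rfl
  intro x hx
  rw [h1, Pi.add_apply] at hx
  by_cases h2 : dolbeaultBar (dolbeaultBarAdjoint o h β) x = 0
  · rw [h2, zero_add] at hx
    exact support_dolbeaultBarAdjoint_subset o ho _ 𝒞 hβ.dolbeaultBar (support_dolbeaultBar_subset 𝒞 hβ hK) x hx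
  · exact support_dolbeaultBar_subset 𝒞 (IsSmoothForm.dolbeaultBarAdjoint o ho h hβ)
      (support_dolbeaultBarAdjoint_subset o ho h 𝒞 hβ hK) x h2

/-- Degree `0` (`Δ_∂̄ = ∂̄*∂̄`, `0 + (m+1) = n`). [cite: WarnerGTM94, 6.33] -/
theorem CL2SmoothForms.exists_subseq_cauchySeq_fun_smul_zero (h : 0 + (m + 1) = n) (𝒞 : CubeCutoff p A)
    {κ : ℝ} (hκ : 0 < κ)
    (hell : (torusLaplacianZero o Fact.out (show (0 + 1) + m = n by omega) 𝒞).IsEllipticWith κ)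
    {ε : ℝ≥0∞} (hpert : (torusLaplacianZero o Fact.out (show (0 + 1) + m = n by omega) 𝒞).PrincipalPerturbationLE ε)
    (hε : ENNReal.ofReal (2 * Real.sqrt 2 / κ) * (Fintype.card (Fin n) : ℝ≥0∞) ^ 2 * ε ≤ 1)
    {εs : ℝ} (hsign : ∀ y ∈ cubeRegion A (extChartAt 𝓘(ℝ, E) p p) 𝒞.ρ, chartSign o p y = εs)
    {φ τ : M → ℝ} (hφ : ContMDiff 𝓘(ℝ, E) 𝓘(ℝ) ∞ φ) (hτ : ContMDiff 𝓘(ℝ, E) 𝓘(ℝ) ∞ τ)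
    (hφ1 : ∀ x, |φ x| ≤ 1) (hτ1 : ∀ x, |τ x| ≤ 1) (hτφ : ∀ x, φ x ≠ 0 → ∀ᶠ w in 𝓝 x, τ w = 1)
    (hKτ : ∀ x, τ x ≠ 0 → x ∈ (extChartAt 𝓘(ℝ, E) p).source ∧
      extChartAt 𝓘(ℝ, E) p x ∈ cubeRegion A (extChartAt 𝓘(ℝ, E) p p) 𝒞.ρ)
    (u : ℕ → CL2SmoothForms o 0) {c : ℝ} (hb : ∀ i, ‖u i‖ ≤ c)
    (hΔ : ∀ i, ‖CL2SmoothForms.dolbeaultLaplacian o h (u i)‖ ≤ c) :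
    ∃ ψ : ℕ → ℕ, StrictMono ψ ∧ CauchySeq (fun i ↦ CL2SmoothForms.mk o (φ • CL2SmoothForms.toForm o (u (ψ i)))
      ((CL2SmoothForms.isSmoothForm_toForm o _).fun_smul' hφ)) := by
  have ho : IsSmoothForm (riemannianVolumeForm o) := Fact.out
  refine CL2SmoothForms.exists_subseq_cauchySeq_fun_smul_of_agreement o 𝒞 _ hκ hell hpert hε hsign
    (dolbeaultLaplacian o 0 (m + 1) h) (fun hβ ↦ IsSmoothForm.dolbeaultLaplacian o ho h hβ)
    (fun {β} hβ hK ↦ ?_) (fun hτφ β ↦ fun_smul_dolbeaultLaplacian_fun_smul o h hτφ β)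
    (fun hβ hK ↦ mFourierCoeff_toTorus_dolbeaultLaplacian_zero o ho h 𝒞 hβ hK)
    (CL2SmoothForms.dolbeaultLaplacian o h) (fun α ↦ rfl) hφ hτ hφ1 hτ1 hτφ hKτ u hb hΔ
  have h1 : dolbeaultLaplacian o 0 (m + 1) h β =
      dolbeaultBarAdjoint o (show (0 + 1) + m = n by omega) (dolbeaultBar β) := rfl
  rw [h1]
  exact support_dolbeaultBarAdjoint_subset o ho _ 𝒞 hβ.dolbeaultBar (support_dolbeaultBar_subset 𝒞 hβ hK)

/-- Top degree (`Δ_∂̄ = ∂̄∂̄*`, `(k+1) + 0 = n`). [cite: WarnerGTM94, 6.33] -/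
theorem CL2SmoothForms.exists_subseq_cauchySeq_fun_smul_top (h : (k + 1) + 0 = n) (𝒞 : CubeCutoff p A)
    {κ : ℝ} (hκ : 0 < κ) (hell : (torusLaplacianTop o Fact.out h 𝒞).IsEllipticWith κ)
    {ε : ℝ≥0∞} (hpert : (torusLaplacianTop o Fact.out h 𝒞).PrincipalPerturbationLE ε)
    (hε : ENNReal.ofReal (2 * Real.sqrt 2 / κ) * (Fintype.card (Fin n) : ℝ≥0∞) ^ 2 * ε ≤ 1)
    {εs : ℝ} (hsign : ∀ y ∈ cubeRegion A (extChartAt 𝓘(ℝ, E) p p) 𝒞.ρ, chartSign o p y = εs)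
    {φ τ : M → ℝ} (hφ : ContMDiff 𝓘(ℝ, E) 𝓘(ℝ) ∞ φ) (hτ : ContMDiff 𝓘(ℝ, E) 𝓘(ℝ) ∞ τ)
    (hφ1 : ∀ x, |φ x| ≤ 1) (hτ1 : ∀ x, |τ x| ≤ 1) (hτφ : ∀ x, φ x ≠ 0 → ∀ᶠ w in 𝓝 x, τ w = 1)
    (hKτ : ∀ x, τ x ≠ 0 → x ∈ (extChartAt 𝓘(ℝ, E) p).source ∧
      extChartAt 𝓘(ℝ, E) p x ∈ cubeRegion A (extChartAt 𝓘(ℝ, E) p p) 𝒞.ρ)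
    (u : ℕ → CL2SmoothForms o (k + 1)) {c : ℝ} (hb : ∀ i, ‖u i‖ ≤ c)
    (hΔ : ∀ i, ‖CL2SmoothForms.dolbeaultLaplacian o h (u i)‖ ≤ c) :
    ∃ ψ : ℕ → ℕ, StrictMono ψ ∧ CauchySeq (fun i ↦ CL2SmoothForms.mk o (φ • CL2SmoothForms.toForm o (u (ψ i)))
      ((CL2SmoothForms.isSmoothForm_toForm o _).fun_smul' hφ)) := by
  have ho : IsSmoothForm (riemannianVolumeForm o) := Fact.out
  refine CL2SmoothForms.exists_subseq_cauchySeq_fun_smul_of_agreement o 𝒞 _ hκ hell hpert hε hsign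
    (dolbeaultLaplacian o (k + 1) 0 h) (fun hβ ↦ IsSmoothForm.dolbeaultLaplacian o ho h hβ)
    (fun {β} hβ hK ↦ ?_) (fun hτφ β ↦ fun_smul_dolbeaultLaplacian_fun_smul o h hτφ β)
    (fun hβ hK ↦ mFourierCoeff_toTorus_dolbeaultLaplacian_top o ho h 𝒞 hβ hK)
    (CL2SmoothForms.dolbeaultLaplacian o h) (fun α ↦ rfl) hφ hτ hφ1 hτ1 hτφ hKτ u hb hΔ
  have h1 : dolbeaultLaplacian o (k + 1) 0 h β = dolbeaultBar (dolbeaultBarAdjoint o h β) := rfl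
  rw [h1]
  exact support_dolbeaultBar_subset 𝒞 (IsSmoothForm.dolbeaultBarAdjoint o ho h hβ)
    (support_dolbeaultBarAdjoint_subset o ho h 𝒞 hβ hK)

end Compactness

end Literature.Geometry.Kaehler
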